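import Summits.ValiantsHypothesis.ValiantsHypothesis.Theorems.TwoProducts.RankThreeAffineToricWronskianLayer

/-!
# Toric Wronskians of monomials, part 4: the FIRST TRUNCATION LAYER — the determinant and the closed form at a v-resonance

Sequel of ✓ `…ToricWronskianLayer` (the column engine `toricW_column_second` and the scalar data `toricWBt`, `toricWSubVec`, `toricWSVec`).
With `v` the unique `ν`-top of `supp u`, `p` the unique second, `N = Σ_{i<K} i = m + 1`, `T′ = Σe_i + m•v + p` (one layer below the corner, towards `p`):
★★ `toricW_layer_coeff` (FIRST-ORDER EXPANSION OF THE DETERMINANT, no resonance hypothesis): `coeff_{T′} W_{J(·,u)}(X^e) = Σ_i det(B[col i ← sub_i])`,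
`B = (β_i^k)_{k,i}`, `sub_i = (0, c^{(i)}_0, c^{(i)}_1, …)` the sub-corner coefficients of column `i` — proved column by column: `toricWLayerMat j` has its
first `j` columns true (`D^k X^{e_i}`) and the rest corner monomials `β_i^k X^{e_i+kv}`; `Matrix.det_updateCol_add` splits the `j`-th column into
corner + sub-corner monomial + rest; the sub-corner term is read off by ✓ `isDomTop_prod` (★ `toricW_layer_sub_term`), the rest term is strictly
ν-below `T′` (★ `toricW_layer_rest_term`), and the all-corner start has no `T′`-coefficient.
★★★ `toricW_first_layer` (CLOSED FORM at a resonance `i₀ ≠ j₀`, `det(e_{i₀},v) = det(e_{j₀},v)`, NO other hypothesis):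
`γ · coeff_{T′} W = u_p · (det(e_{i₀}, p) − det(e_{j₀}, p)) · det Vandermonde(β⁺)`, `γ = u_v det(p,v)`, `β⁺ = β[i₀ ↦ β_{i₀} + γ]` — only columns `i₀, j₀`
survive, their `E`-parts cancel by the swap antisymmetry, the `S`-parts telescope.  VANISHING ⟺ a further coincidence among `β⁺`: another resonant pair,
or a MERGE `β_{i₀} + γ = β_{i'}`, i.e. `det(e_{i'} − e_{i₀} − p, v) = 0` (NOTE e7f9f5e1cec2d957).  Numerics (scratch `w20.py`): 280/280 exact, 12 merges.
WHAT THIS GIVES toward (TW-flag): at a simple resonance without merge the dead corner `N•v` is replaced, as `ν` sweeps the cone of `v`, by `(N−1)•v + p(ν)`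
— a translate of the chain of `conv(supp u ∖ {v})` facing `v`: NO edge direction outside the pair directions of `supp u` arises at depth 1; new directions
need depth ≥ 2 (multiple resonances / merges) — the located residue.  NOT in this file: that `T′` IS the ν-top when the coefficient is non-zero (the
domination half), and depth ≥ 2.  HONEST LABEL: exact engine / located cell on the OPEN rung 3-AFF (side ladder, crux `stmt-ValiantsHypothesis-5906`
`TwoProducts`); (TW-flag) at depth ≥ 2, `OLMLaw`, `RankThreeAffineLaw(Exp)`, `TwoProducts`, PCB, `ResidualLawV25` UNMOVED; 0 summit distance; VP ≠ VNP is
NOT proved.  `--supports stmt-ValiantsHypothesis-5906 --as helper` (val-port-4 g5; critic of record val-idea-crit-8 g5).  One new def (`toricWLayerMat`,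
with parameters); no instances, no notation, no named facts. [folklore]
-/

noncomputable section
set_option linter.dupNamespace false

namespace Summit.ValiantsHypothesis.ValiantsHypothesis.Theorems.TwoProducts.RankTwoJacobian

open scoped BigOperators
open MvPolynomial
open Literature.LinearAlgebra.Matrix (wronskianMatrix wronskian wronskianMatrix_apply wronskian_def)

section TowerKernel
open scoped Classical


/-! ### §1 The determinant, column by column -/

/-- a product of monomials. [folklore] -/
theorem toricW_prod_monomial {ι : Type*} (s : Finset ι) (a : ι → Expo) (c : ι → ℂ) :
    ∏ i ∈ s, (monomial (a i) (c i) : Poly2) = monomial (∑ i ∈ s, a i) (∏ i ∈ s, c i) := by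
  induction s using Finset.induction_on with
  | empty => rw [Finset.prod_empty, Finset.sum_empty, Finset.prod_empty, ← C_1, C_apply]
  | insert b s hb ih => rw [Finset.prod_insert hb, Finset.sum_insert hb, Finset.prod_insert hb, ih, monomial_mul]

/-- `wt` of a finite sum of exponents. [folklore] -/
theorem wt_finset_sum {ι : Type*} (s : Finset ι) (ν : Fin 2 → ℝ) (a : ι → Expo) :
    wt ν (∑ i ∈ s, a i) = ∑ i ∈ s, wt ν (a i) := by
  induction s using Finset.induction_on with
  | empty => rw [Finset.sum_empty, Finset.sum_empty, wt_zero_expo]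
  | insert b s hb ih => rw [Finset.sum_insert hb, Finset.sum_insert hb, wt_add, ih]

/-- the PARTIALLY EXPANDED Wronskian matrix: columns `i < j` are the true columns `D^k X^{e_i}`, columns `i ≥ j` only their corner monomials
`β_i^k X^{e_i + k•v}`. [folklore] -/
def toricWLayerMat (u : Poly2) (v : Expo) {K : ℕ} (e : Fin K → Expo) (j : ℕ) : Matrix (Fin K) (Fin K) Poly2 :=
  Matrix.of fun k i => if (i : ℕ) < j then (⇑(jacDer u))^[(k : ℕ)] (monomial (e i) (1 : ℂ))
    else monomial (e i + (k : ℕ) • v) (toricWCornerWt u v e i ^ (k : ℕ))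

/-- every entry of the partially expanded matrix is `ν`-dominated by its corner with coefficient `β_i^k`. [folklore] -/
theorem toricWLayerMat_dom {ν : Fin 2 → ℝ} {u : Poly2} {v : Expo} (hv : IsUniqueTop ν u v) {K : ℕ} (e : Fin K → Expo) (j : ℕ)
    (k i : Fin K) : IsDomTop ν (toricWLayerMat u v e j k i) (e i + (k : ℕ) • v) ∧
      coeff (e i + (k : ℕ) • v) (toricWLayerMat u v e j k i) = toricWCornerWt u v e i ^ (k : ℕ) := by
  unfold toricWLayerMat
  rw [Matrix.of_apply]
  by_cases h : (i : ℕ) < j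
  · rw [if_pos h]
    obtain ⟨hd, hc⟩ := isDomTop_iterate_jacDer hv (e i) 1 k
    rw [hc, one_mul]
    exact ⟨hd, rfl⟩
  · rw [if_neg h, coeff_monomial, if_pos rfl]
    exact ⟨isDomTop_monomial ν _ _, rfl⟩

/-- at `j = K` the partially expanded matrix is the Wronskian matrix. [folklore] -/
theorem toricWLayerMat_top (u : Poly2) (v : Expo) {K : ℕ} (e : Fin K → Expo) :
    toricWLayerMat u v e K = wronskianMatrix (⇑(jacDer u)) (fun i => monomial (e i) (1 : ℂ)) := by
  ext k i
  unfold toricWLayerMat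
  rw [Matrix.of_apply, if_pos i.isLt, wronskianMatrix_apply]

/-- the step: expanding column `j`. [folklore] -/
theorem toricWLayerMat_succ (u : Poly2) (v : Expo) {K : ℕ} (e : Fin K → Expo) {j : ℕ} (hj : j < K) :
    toricWLayerMat u v e (j + 1) =
      (toricWLayerMat u v e j).updateCol ⟨j, hj⟩ (fun k => (⇑(jacDer u))^[(k : ℕ)] (monomial (e ⟨j, hj⟩) (1 : ℂ))) := by
  ext k i
  unfold toricWLayerMat
  rw [Matrix.updateCol_apply, Matrix.of_apply, Matrix.of_apply]
  by_cases hi : i = ⟨j, hj⟩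
  · subst hi; rw [if_pos (Nat.lt_succ_self j), if_pos rfl]
  · have hij : (i : ℕ) ≠ j := fun h => hi (Fin.ext h)
    rw [if_neg hi]
    by_cases h : (i : ℕ) < j
    · rw [if_pos h, if_pos (by omega)]
    · rw [if_neg h, if_neg (by omega)]

/-- ★ THE SUB-CORNER TERM OF ONE COLUMN EXPANSION: `coeff_{T′} det(M_j[col j ← Sub_j]) = det(B[col j ← sub_j])`. -/
theorem toricW_layer_sub_term {ν : Fin 2 → ℝ} {u : Poly2} {v p : Expo} (hv : IsUniqueTop ν u v) {K : ℕ} (e : Fin K → Expo)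
    {m : ℕ} (hm : m + 1 = ∑ i : Fin K, (i : ℕ)) {j : ℕ} (hj : j < K) :
    coeff ((∑ i, e i) + m • v + p) (((toricWLayerMat u v e j).updateCol ⟨j, hj⟩ (toricWSubCol u v p e ⟨j, hj⟩)).det) =
      ((toricWBt u v e).updateCol ⟨j, hj⟩ (toricWSubVec u v p e ⟨j, hj⟩)).det := by
  rw [Matrix.det_apply, Matrix.det_apply, coeff_sum]
  refine Finset.sum_congr rfl fun σ _ => ?_
  rw [coeff_units_smul]
  congr 1
  set jj : Fin K := ⟨j, hj⟩ with hjj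
  rcases Nat.eq_zero_or_eq_succ_pred (σ jj : ℕ) with h0 | hs
  · -- row 0 in column j: both products vanish
    have hz1 : ∏ i, (toricWLayerMat u v e j).updateCol jj (toricWSubCol u v p e jj) (σ i) i = 0 :=
      Finset.prod_eq_zero (Finset.mem_univ jj) (by rw [Matrix.updateCol_self]; exact (toricWSubCol_zero u v p e jj _ h0).2)
    have hz2 : ∏ i, (toricWBt u v e).updateCol jj (toricWSubVec u v p e jj) (σ i) i = 0 :=
      Finset.prod_eq_zero (Finset.mem_univ jj) (by rw [Matrix.updateCol_self]; exact (toricWSubCol_zero u v p e jj _ h0).1)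
    rw [hz1, hz2, coeff_zero]
  · set k' := (σ jj : ℕ).pred with hk'
    obtain ⟨hvec, hcol⟩ := toricWSubCol_succ u v p e jj (σ jj) hs
    -- dominating points
    set w : Fin K → ℕ := Function.update (fun i => (σ i : ℕ)) jj k' with hw
    set P : Fin K → Expo := fun i => e i + w i • v + Function.update (fun _ => (0 : Expo)) jj p i with hP
    have hwj : w jj = k' := by rw [hw, Function.update_self]
    have hwi : ∀ i, i ≠ jj → w i = (σ i : ℕ) := fun i hi => by rw [hw, Function.update_of_ne hi]
    have hsum1 : ∑ i ∈ (Finset.univ : Finset (Fin K)).erase jj, (σ i : ℕ) = ∑ i ∈ (Finset.univ : Finset (Fin K)).erase jj, w i :=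
      Finset.sum_congr rfl fun i hi => (hwi i (Finset.ne_of_mem_erase hi)).symm
    have hsumσ : ∑ i, (σ i : ℕ) = ∑ i, w i + 1 := by
      rw [← Finset.sum_erase_add _ _ (Finset.mem_univ jj), ← Finset.sum_erase_add _ w (Finset.mem_univ jj), hsum1, hwj, hs]
      omega
    have hwm : ∑ i, w i = m := by
      have := Equiv.sum_comp σ (fun i : Fin K => (i : ℕ))
      omega
    have hupd : ∑ i, Function.update (fun _ => (0 : Expo)) jj p i = p := by
      rw [Finset.sum_eq_single_of_mem jj (Finset.mem_univ _) fun i _ hi => by rw [Function.update_of_ne hi],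
        Function.update_self]
    have hPsum : ∑ i, P i = (∑ i, e i) + m • v + p := by
      rw [hP]
      simp only
      rw [Finset.sum_add_distrib, Finset.sum_add_distrib, ← Finset.sum_smul, hwm, hupd]
    have hPj : P jj = e jj + k' • v + p := by
      rw [hP]; simp only; rw [hwj, Function.update_self]
    have hPi : ∀ i, i ≠ jj → P i = e i + (σ i : ℕ) • v := fun i hi => by
      rw [hP]; simp only; rw [hwi i hi, Function.update_of_ne hi, add_zero]
    have hdom : ∀ i ∈ (Finset.univ : Finset (Fin K)),
        IsDomTop ν ((toricWLayerMat u v e j).updateCol jj (toricWSubCol u v p e jj) (σ i) i) (P i) := by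
      intro i _
      rw [Matrix.updateCol_apply]
      by_cases h : i = jj
      · subst h
        rw [if_pos rfl, hcol, hPj]
        exact isDomTop_monomial ν _ _
      · rw [if_neg h, hPi i h]
        exact (toricWLayerMat_dom hv e j (σ i) i).1
    obtain ⟨_, hc⟩ := isDomTop_prod Finset.univ hdom
    rw [hPsum] at hc
    rw [hc]
    refine Finset.prod_congr rfl fun i _ => ?_
    rw [Matrix.updateCol_apply, Matrix.updateCol_apply]
    by_cases h : i = jj
    · subst h
      rw [if_pos rfl, if_pos rfl, hcol, hPj, coeff_monomial, if_pos rfl]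
    · rw [if_neg h, if_neg h, hPi i h, (toricWLayerMat_dom hv e j (σ i) i).2]
      rfl

/-- ★ THE REST TERM OF ONE COLUMN EXPANSION CONTRIBUTES NOTHING AT `T′`. -/
theorem toricW_layer_rest_term {ν : Fin 2 → ℝ} {u : Poly2} {v p : Expo} (hv : IsUniqueTop ν u v) (hp : p ∈ u.support) (hpv : p ≠ v)
    (hp2 : ∀ s ∈ u.support, s ≠ v → s ≠ p → wt ν s < wt ν p) {K : ℕ} (e : Fin K → Expo)
    {m : ℕ} (hm : m + 1 = ∑ i : Fin K, (i : ℕ)) {j : ℕ} (hj : j < K) :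
    coeff ((∑ i, e i) + m • v + p) (((toricWLayerMat u v e j).updateCol ⟨j, hj⟩
      (fun k => (⇑(jacDer u))^[(k : ℕ)] (monomial (e ⟨j, hj⟩) (1 : ℂ)) - toricWLayerMat u v e j k ⟨j, hj⟩
        - toricWSubCol u v p e ⟨j, hj⟩ k)).det) = 0 := by
  rw [Matrix.det_apply, coeff_sum]
  refine Finset.sum_eq_zero fun σ _ => ?_
  rw [coeff_units_smul]
  set jj : Fin K := ⟨j, hj⟩ with hjj
  -- the rest column
  set rest : Fin K → Poly2 := fun k => (⇑(jacDer u))^[(k : ℕ)] (monomial (e jj) (1 : ℂ)) - toricWLayerMat u v e j k jj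
        - toricWSubCol u v p e jj k with hrest
  rcases Nat.eq_zero_or_eq_succ_pred (σ jj : ℕ) with h0 | hs
  · have hz : ∏ i, (toricWLayerMat u v e j).updateCol jj rest (σ i) i = 0 := by
      refine Finset.prod_eq_zero (Finset.mem_univ jj) ?_
      rw [Matrix.updateCol_self, hrest]
      simp only
      rw [(toricWSubCol_zero u v p e jj _ h0).2, sub_zero]
      unfold toricWLayerMat
      rw [Matrix.of_apply, if_neg (lt_irrefl j), h0, Function.iterate_zero_apply, zero_smul, add_zero, pow_zero, sub_self]
    rw [hz, coeff_zero, smul_zero]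
  · set k' := (σ jj : ℕ).pred with hk'
    obtain ⟨hvec, hcol⟩ := toricWSubCol_succ u v p e jj (σ jj) hs
    obtain ⟨hsec, hcoef⟩ := toricW_column_second hv hp hpv hp2 (e jj) k'
    -- weights of the rest column in row σ jj: strictly below the sub-corner
    have hrest_lt : ∀ s ∈ (rest (σ jj)).support, wt ν s < wt ν (e jj + k' • v + p) := by
      intro s hs'
      have hsR := MvPolynomial.mem_support_iff.mp hs'
      have hcor : toricWLayerMat u v e j (σ jj) jj = monomial (e jj + (k' + 1) • v) (toricWCornerWt u v e jj ^ (k' + 1)) := by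
        unfold toricWLayerMat; rw [Matrix.of_apply, if_neg (lt_irrefl j), hs]
      have hc : coeff s (rest (σ jj)) = coeff s ((⇑(jacDer u))^[k' + 1] (monomial (e jj) (1 : ℂ)))
          - (if e jj + (k' + 1) • v = s then toricWCornerWt u v e jj ^ (k' + 1) else 0)
          - (if e jj + k' • v + p = s then toricWSubVec u v p e jj (σ jj) else 0) := by
        rw [hrest]; simp only; rw [hcor, hcol, hs, coeff_sub, coeff_sub, coeff_monomial, coeff_monomial]
      have hcorner := (isDomTop_iterate_jacDer hv (e jj) 1 (k' + 1)).2
      rw [one_mul] at hcorner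
      have hne : e jj + (k' + 1) • v ≠ e jj + k' • v + p := by
        intro h
        have h' := congrArg (wt ν) h
        rw [wt_add, wt_add, wt_add, succ_nsmul, wt_add] at h'
        have := hv.2 p hp hpv
        linarith
      by_cases h1 : s = e jj + (k' + 1) • v
      · subst h1
        rw [if_pos rfl, if_neg (Ne.symm hne).symm.symm, sub_zero, hcorner] at hc
        · exact absurd (by rw [hc]; unfold toricWCornerWt; ring) hsR
      · by_cases h2 : s = e jj + k' • v + p
        · subst h2
          rw [if_neg hne, if_pos rfl, sub_zero, hcoef, hvec] at hc
          exact absurd (by rw [hc]; unfold toricWCornerWt; ring) hsR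
        · rw [if_neg (Ne.symm h1), if_neg (Ne.symm h2), sub_zero, sub_zero] at hc
          exact hsec s (MvPolynomial.mem_support_iff.mpr (hc ▸ hsR)) h1 h2
    -- weights of the other factors
    have hothers : ∀ i ∈ (Finset.univ : Finset (Fin K)).erase jj,
        ∀ s ∈ ((toricWLayerMat u v e j).updateCol jj rest (σ i) i).support, wt ν s ≤ wt ν (e i + (σ i : ℕ) • v) := by
      intro i hi
      rw [Matrix.updateCol_apply, if_neg (Finset.ne_of_mem_erase hi)]
      exact (toricWLayerMat_dom hv e j (σ i) i).1.le
    have hprod := wt_le_of_mem_support_prod _ hothers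
    have hsplit : ∏ i, (toricWLayerMat u v e j).updateCol jj rest (σ i) i =
        (∏ i ∈ (Finset.univ : Finset (Fin K)).erase jj, (toricWLayerMat u v e j).updateCol jj rest (σ i) i) *
          (toricWLayerMat u v e j).updateCol jj rest (σ jj) jj :=
      (Finset.prod_erase_mul _ _ (Finset.mem_univ jj)).symm
    rw [hsplit]
    have hjfac : (toricWLayerMat u v e j).updateCol jj rest (σ jj) jj = rest (σ jj) := by rw [Matrix.updateCol_self]
    rw [hjfac]
    have hlt := wt_lt_of_mem_support_mul hprod hrest_lt
    -- the total weight is `wt T′`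
    have hT : (∑ i ∈ (Finset.univ : Finset (Fin K)).erase jj, wt ν (e i + (σ i : ℕ) • v)) + wt ν (e jj + k' • v + p) =
        wt ν ((∑ i, e i) + m • v + p) := by
      set w : Fin K → ℕ := Function.update (fun i => (σ i : ℕ)) jj k' with hw
      have hwj : w jj = k' := by rw [hw, Function.update_self]
      have hwi : ∀ i, i ≠ jj → w i = (σ i : ℕ) := fun i hi => by rw [hw, Function.update_of_ne hi]
      have hsum1 : ∑ i ∈ (Finset.univ : Finset (Fin K)).erase jj, (σ i : ℕ) = ∑ i ∈ (Finset.univ : Finset (Fin K)).erase jj, w i :=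
        Finset.sum_congr rfl fun i hi => (hwi i (Finset.ne_of_mem_erase hi)).symm
      have hsumσ : ∑ i, (σ i : ℕ) = ∑ i, w i + 1 := by
        rw [← Finset.sum_erase_add _ _ (Finset.mem_univ jj), ← Finset.sum_erase_add _ w (Finset.mem_univ jj), hsum1, hwj, hs]
        omega
      have hwm : ∑ i, w i = m := by
        have := Equiv.sum_comp σ (fun i : Fin K => (i : ℕ))
        omega
      have hupd : ∑ i, Function.update (fun _ => (0 : Expo)) jj p i = p := by
        rw [Finset.sum_eq_single_of_mem jj (Finset.mem_univ _) fun i _ hi => by rw [Function.update_of_ne hi],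
          Function.update_self]
      have hPsum : ∑ i, (e i + w i • v + Function.update (fun _ => (0 : Expo)) jj p i) = (∑ i, e i) + m • v + p := by
        rw [Finset.sum_add_distrib, Finset.sum_add_distrib, ← Finset.sum_smul, hwm, hupd]
      rw [← hPsum, wt_finset_sum, ← Finset.sum_erase_add _ _ (Finset.mem_univ jj), hwj, Function.update_self]
      congr 1
      refine Finset.sum_congr rfl fun i hi => ?_
      rw [hwi i (Finset.ne_of_mem_erase hi), Function.update_of_ne (Finset.ne_of_mem_erase hi), add_zero]
    rw [hT] at hlt
    rw [coeff_eq_zero_of_wt_lt hlt, smul_zero]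

/-- ★★ **THE FIRST TRUNCATION LAYER, STRUCTURAL FORM:** with `N = Σ_{i<K} i = m + 1`, the coefficient of `W_{J(·,u)}(X^e)` at
`T′ = Σe_i + m•v + p` (one step below the corner `Σe_i + N•v`, towards the second support point `p`) is the FIRST-ORDER EXPANSION
`Σ_i det(B[col i ← sub_i])`, `B = (β_i^k)`, `sub_i = (0, c_i(0), c_i(1), …)` the sub-corner coefficients of column `i`. -/
theorem toricW_layer_coeff {ν : Fin 2 → ℝ} {u : Poly2} {v p : Expo} (hv : IsUniqueTop ν u v) (hp : p ∈ u.support) (hpv : p ≠ v)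
    (hp2 : ∀ s ∈ u.support, s ≠ v → s ≠ p → wt ν s < wt ν p) {K : ℕ} (e : Fin K → Expo)
    {m : ℕ} (hm : m + 1 = ∑ i : Fin K, (i : ℕ)) :
    coeff ((∑ i, e i) + m • v + p) (wronskian (⇑(jacDer u)) (fun i => monomial (e i) (1 : ℂ))) =
      ∑ i : Fin K, ((toricWBt u v e).updateCol i (toricWSubVec u v p e i)).det := by
  -- induction on the number `j` of expanded columns
  have key : ∀ j, j ≤ K → coeff ((∑ i, e i) + m • v + p) (toricWLayerMat u v e j).det =
      ∑ i : Fin K, if (i : ℕ) < j then ((toricWBt u v e).updateCol i (toricWSubVec u v p e i)).det else 0 := by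
    intro j
    induction j with
    | zero =>
      intro _
      -- all columns are corner monomials: `det = (…)·X^T`, and `T ≠ T′`
      have hz : ∀ i : Fin K, ¬ ((i : ℕ) < 0) := fun i => Nat.not_lt_zero _
      simp only [Nat.not_lt_zero, if_false, Finset.sum_const_zero]
      rw [Matrix.det_apply, coeff_sum]
      refine Finset.sum_eq_zero fun σ _ => ?_
      rw [coeff_units_smul]
      have hprod : ∏ i, toricWLayerMat u v e 0 (σ i) i =
          monomial (∑ i, (e i + (σ i : ℕ) • v)) (∏ i, toricWCornerWt u v e i ^ (σ i : ℕ)) := by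
        rw [← toricW_prod_monomial]
        refine Finset.prod_congr rfl fun i _ => ?_
        unfold toricWLayerMat; rw [Matrix.of_apply, if_neg (Nat.not_lt_zero _)]
      rw [hprod, coeff_monomial, if_neg, smul_zero]
      intro h
      have h' := congrArg (wt ν) h
      have hT : ∑ i, (e i + (σ i : ℕ) • v) = (∑ i, e i) + (m + 1) • v := by
        rw [Finset.sum_add_distrib, ← Finset.sum_smul, Equiv.sum_comp σ (fun i : Fin K => (i : ℕ)), ← hm]
      rw [hT, wt_add, wt_add, wt_add, succ_nsmul, wt_add] at h'
      have := hv.2 p hp hpv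
      linarith
    | succ j ih =>
      intro hj
      have hjK : j < K := by omega
      have hfull : (fun k : Fin K => (⇑(jacDer u))^[(k : ℕ)] (monomial (e ⟨j, hjK⟩) (1 : ℂ))) =
          (fun k : Fin K => toricWLayerMat u v e j k ⟨j, hjK⟩) + toricWSubCol u v p e ⟨j, hjK⟩ +
            (fun k : Fin K => (⇑(jacDer u))^[(k : ℕ)] (monomial (e ⟨j, hjK⟩) (1 : ℂ)) - toricWLayerMat u v e j k ⟨j, hjK⟩
              - toricWSubCol u v p e ⟨j, hjK⟩ k) := by
        funext k; simp only [Pi.add_apply]; ring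
      rw [toricWLayerMat_succ u v e hjK, hfull, Matrix.det_updateCol_add, Matrix.det_updateCol_add, coeff_add, coeff_add,
        Matrix.updateCol_eq_self, ih (by omega), toricW_layer_sub_term hv e hm hjK,
        toricW_layer_rest_term hv hp hpv hp2 e hm hjK, add_zero]
      -- the partial sums
      have hsplit : ∀ i : Fin K, (if (i : ℕ) < j + 1 then ((toricWBt u v e).updateCol i (toricWSubVec u v p e i)).det else 0) =
          (if (i : ℕ) < j then ((toricWBt u v e).updateCol i (toricWSubVec u v p e i)).det else 0) +
          (if i = ⟨j, hjK⟩ then ((toricWBt u v e).updateCol i (toricWSubVec u v p e i)).det else 0) := by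
        intro i
        by_cases h1 : (i : ℕ) < j
        · rw [if_pos (by omega), if_pos h1, if_neg (fun h => by rw [h] at h1; exact lt_irrefl _ h1), add_zero]
        · by_cases h2 : i = ⟨j, hjK⟩
          · subst h2; rw [if_pos (Nat.lt_succ_self j), if_neg h1, if_pos rfl, zero_add]
          · have : (i : ℕ) ≠ j := fun h => h2 (Fin.ext h)
            rw [if_neg (by omega), if_neg h1, if_neg h2, add_zero]
      simp_rw [hsplit]
      rw [Finset.sum_add_distrib, Finset.sum_ite_eq' Finset.univ (⟨j, hjK⟩ : Fin K), if_pos (Finset.mem_univ _)]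
  have := key K le_rfl
  rw [toricWLayerMat_top] at this
  rw [wronskian_def, this]
  exact Finset.sum_congr rfl fun i _ => if_pos i.isLt

/-! ### §2 The closed form at a v-resonance `β_{i₀} = β_{j₀}` -/

/-- ★★★ **THE FIRST TRUNCATION LAYER AT A v-RESONANCE (closed form).**  Let `v` be the unique `ν`-top of `supp u`, `p ∈ supp u ∖ {v}` dominating
the rest of `supp u` (the unique second), and let the columns `i₀ ≠ j₀` be v-RESONANT: `det(e_{i₀}, v) = det(e_{j₀}, v)` (so the corner
`Σe + N•v` of the Wronskian is dead, ✓ `toricW_corner`).  Then the coefficient of `W_{J(·,u)}(X^e)` one layer down, at `T′ = Σe_i + (N−1)•v + p`, is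
`γ · coeff_{T′} W = u_p · (det(e_{i₀}, p) − det(e_{j₀}, p)) · det Vandermonde(β⁺)`, `γ = u_v det(p,v)`, `β_i = u_v det(e_i, v)`,
`β⁺ = β[i₀ ↦ β_{i₀} + γ]` — NO further hypothesis (extra coincidences kill both sides).  It vanishes iff a MERGE `β_{i₀} + γ = β_{i'}` occurs or two
other columns resonate. -/
theorem toricW_first_layer {ν : Fin 2 → ℝ} {u : Poly2} {v p : Expo} (hv : IsUniqueTop ν u v) (hp : p ∈ u.support) (hpv : p ≠ v)
    (hp2 : ∀ s ∈ u.support, s ≠ v → s ≠ p → wt ν s < wt ν p) {K : ℕ} (e : Fin K → Expo)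
    {m : ℕ} (hm : m + 1 = ∑ i : Fin K, (i : ℕ)) {i₀ j₀ : Fin K} (hne : i₀ ≠ j₀) (hres : idet (e i₀) v = idet (e j₀) v) :
    (coeff v u * ((idet p v : ℤ) : ℂ)) * coeff ((∑ i, e i) + m • v + p) (wronskian (⇑(jacDer u)) (fun i => monomial (e i) (1 : ℂ))) =
      coeff p u * (((idet (e i₀) p : ℤ) : ℂ) - ((idet (e j₀) p : ℤ) : ℂ)) *
        (Matrix.vandermonde (Function.update (toricWCornerWt u v e) i₀
          (toricWCornerWt u v e i₀ + coeff v u * ((idet p v : ℤ) : ℂ)))).det := by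
  have hβ : toricWCornerWt u v e i₀ = toricWCornerWt u v e j₀ := by unfold toricWCornerWt; rw [hres]
  set B := toricWBt u v e with hB
  set γ : ℂ := coeff v u * ((idet p v : ℤ) : ℂ) with hγ
  set μ : ℂ := coeff p u with hμ
  rw [toricW_layer_coeff hv hp hpv hp2 e hm,
    Fintype.sum_eq_add i₀ j₀ hne fun i hi => toricWBt_det_updateCol_eq_zero u v e hne hβ hi.1 hi.2 _,
    toricWBt_det_updateCol_swap u v e hne hβ, ← sub_eq_add_neg]
  -- `det U(a) − det U(b) = det U(a − b)`
  have hsub : (B.updateCol i₀ (toricWSubVec u v p e i₀)).det - (B.updateCol i₀ (toricWSubVec u v p e j₀)).det =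
      (B.updateCol i₀ (toricWSubVec u v p e i₀ - toricWSubVec u v p e j₀)).det := by
    rw [sub_eq_iff_eq_add, ← Matrix.det_updateCol_add, sub_add_cancel]
  rw [hsub, toricWSubVec_sub u v p e hβ, Matrix.det_updateCol_smul]
  -- multiply by `γ` and telescope
  have hγS : γ * (B.updateCol i₀ (toricWSVec (toricWCornerWt u v e i₀) γ μ)).det = μ * ((B.updateCol i₀ (fun k : Fin K => (toricWCornerWt u v e i₀ + γ) ^ (k : ℕ))).det -
      (B.updateCol i₀ (fun k : Fin K => toricWCornerWt u v e i₀ ^ (k : ℕ))).det) := by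
    rw [← Matrix.det_updateCol_smul, toricWSVec_gamma_smul, Matrix.det_updateCol_smul]
    congr 1
    rw [eq_sub_iff_add_eq, ← Matrix.det_updateCol_add, sub_add_cancel]
  have hself : (B.updateCol i₀ (fun k : Fin K => toricWCornerWt u v e i₀ ^ (k : ℕ))).det = 0 := by
    have : (fun k : Fin K => toricWCornerWt u v e i₀ ^ (k : ℕ)) = fun k => B k i₀ := by
      funext k; rw [hB]; unfold toricWBt; rw [Matrix.of_apply]
    rw [this, Matrix.updateCol_eq_self]
    refine Matrix.det_zero_of_column_eq hne fun k => ?_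
    rw [hB]; unfold toricWBt; rw [Matrix.of_apply, Matrix.of_apply, hβ]
  calc γ * ((((idet (e i₀) p : ℤ) : ℂ) - ((idet (e j₀) p : ℤ) : ℂ)) * (B.updateCol i₀ (toricWSVec (toricWCornerWt u v e i₀) γ μ)).det)
      = (((idet (e i₀) p : ℤ) : ℂ) - ((idet (e j₀) p : ℤ) : ℂ)) * (γ * (B.updateCol i₀ (toricWSVec (toricWCornerWt u v e i₀) γ μ)).det) := by ring
    _ = (((idet (e i₀) p : ℤ) : ℂ) - ((idet (e j₀) p : ℤ) : ℂ)) *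
          (μ * ((B.updateCol i₀ (fun k : Fin K => (toricWCornerWt u v e i₀ + γ) ^ (k : ℕ))).det - 0)) := by rw [hγS, hself]
    _ = μ * (((idet (e i₀) p : ℤ) : ℂ) - ((idet (e j₀) p : ℤ) : ℂ)) *
          (Matrix.vandermonde (Function.update (toricWCornerWt u v e) i₀ (toricWCornerWt u v e i₀ + γ))).det := by
        rw [sub_zero, hB, toricWBt_updateCol_shift]; ring

end TowerKernel

end Summit.ValiantsHypothesis.ValiantsHypothesis.Theorems.TwoProducts.RankTwoJacobian

end
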